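import Mathlib.Analysis.Fourier.Inversion
import Mathlib.Analysis.SpecialFunctions.ImproperIntegrals
import Mathlib.MeasureTheory.Integral.Prod
import Mathlib.MeasureTheory.Integral.IntervalIntegral.Basic
import HarnessLib

/-!
# The two-sided exponential kernel `e^{-c|v|}`: Fourier pair and the Plancherel form of its
# quadratic form

Analysis/Fourier support file (everything proved; no definitions, no named facts).

For `c > 0` the (unnormalised) Fourier transform of the two-sided exponential is the Cauchy
(Abel–Poisson) multiplier,

  `∫_ℝ e^{-c|v|} e^{iwv} dv = 2c / (c² + w²)`      (`integral_exp_neg_mul_abs_mul_cexp`),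

equivalently, in Mathlib's normalisation, `𝓕[e^{-c|·|}](w) = 2c / (c² + (2πw)²)`
(`fourier_exp_neg_mul_abs`); by Fourier inversion (Mathlib's `Continuous.fourierInv_fourier_eq`,
both sides being integrable)

  `e^{-c|v|} = (1/2π) ∫_ℝ (2c/(c² + z²)) e^{izv} dz`      (`exp_neg_mul_abs_eq_integral`),

and hence, by Fubini, the quadratic form of the kernel `e^{-c|t-u|}` against an integrable `f` is
the (manifestly non-negative) spectral integral

  `∫∫ e^{-c|t-u|} f(u) conj f(t) du dt = (1/2π) ∫_ℝ (2c/(c²+z²)) |f̂(z)|² dz`,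
  `f̂(z) = ∫ f(x) e^{izx} dx`      (`integral_prod_exp_neg_mul_abs_sub`, iterated form
  `integral_integral_exp_neg_mul_abs_sub`, non-negativity `integral_integral_exp_neg_mul_abs_sub_nonneg`).

This is the `e^{-c|v|} ↔ 2c/(c²+z²)` instance of Bochner's theorem, used in
`Literature/NumberTheory/LFunctions/ZetaScrewThm43Proofs.lean` (the archimedean part of Suzuki's
hermitian form, [Suzuki2023, §4.4]) where the transform is written `∫ f(x)e^{izx}dx` as in that
corpus (`suzukiHat`); the statements below spell the transform out as an integral so that this file
depends on Mathlib only.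

## References

* L. Grafakos, *Classical Fourier Analysis*, 3rd ed., GTM 249, Springer (2014): Exercise 2.2.11 (b)
  (the Poisson-kernel pair `(e^{-2π|x|})^ = Γ((n+1)/2)π^{-(n+1)/2}(1+|ξ|²)^{-(n+1)/2}`, PDF p. 133),
  Example 1.2.16 (`P ∈ L¹`, PDF p. 49), §2.2.4 / Exercise 2.2.6 (inversion on `L¹`, PDF p. 129).
  [Grafakos2014]
* M. Suzuki, *Aspects of the screw function corresponding to the Riemann zeta-function*,
  J. Lond. Math. Soc. (2) 108 (2023), §4.3, eqs. (4.9)–(4.10) (the kernel/multiplier identity this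
  file instantiates). [Suzuki2023]
* S. Bochner, *Vorlesungen über Fouriersche Integrale* (1932), §20 (background).
-/

noncomputable section

open MeasureTheory Set Complex Real Filter
open scoped ComplexConjugate FourierTransform Topology

namespace Literature.Analysis.Fourier

/-! ### The Fourier transform of `e^{-c|v|}` -/

/-- On `(0, ∞)`: `e^{-c|v|} e^{iwv} = e^{(-c + iw)v}`. [folklore] -/
private theorem exp_neg_mul_abs_mul_cexp_eq_of_pos (c w : ℝ) {v : ℝ} (hv : 0 < v) :
    (Real.exp (-(c * |v|)) : ℂ) * cexp (I * w * v) = cexp ((-c + I * w) * v) := by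
  rw [abs_of_pos hv, Complex.ofReal_exp, ← Complex.exp_add]
  congr 1
  push_cast
  ring

/-- On `(-∞, 0]`: `e^{-c|v|} e^{iwv} = e^{(c + iw)v}`. [folklore] -/
private theorem exp_neg_mul_abs_mul_cexp_eq_of_nonpos (c w : ℝ) {v : ℝ} (hv : v ≤ 0) :
    (Real.exp (-(c * |v|)) : ℂ) * cexp (I * w * v) = cexp ((c + I * w) * v) := by
  rw [abs_of_nonpos hv, Complex.ofReal_exp, ← Complex.exp_add]
  congr 1
  push_cast
  ring

/-- `v ↦ e^{-c|v|} e^{iwv}` is integrable on `(0, ∞)` (`c > 0`). [folklore] -/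
private theorem integrableOn_exp_neg_mul_abs_mul_cexp_Ioi {c : ℝ} (hc : 0 < c) (w : ℝ) :
    IntegrableOn (fun v : ℝ ↦ (Real.exp (-(c * |v|)) : ℂ) * cexp (I * w * v)) (Ioi 0) := by
  have ha : (-(c : ℂ) + I * w).re < 0 := by simp [hc]
  exact (integrableOn_exp_mul_complex_Ioi ha 0).congr_fun
    (fun v hv ↦ (exp_neg_mul_abs_mul_cexp_eq_of_pos c w hv).symm) measurableSet_Ioi

/-- `v ↦ e^{-c|v|} e^{iwv}` is integrable on `(-∞, 0]` (`c > 0`). [folklore] -/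
private theorem integrableOn_exp_neg_mul_abs_mul_cexp_Iic {c : ℝ} (hc : 0 < c) (w : ℝ) :
    IntegrableOn (fun v : ℝ ↦ (Real.exp (-(c * |v|)) : ℂ) * cexp (I * w * v)) (Iic 0) := by
  have ha : 0 < ((c : ℂ) + I * w).re := by simp [hc]
  exact (integrableOn_exp_mul_complex_Iic ha 0).congr_fun
    (fun v hv ↦ (exp_neg_mul_abs_mul_cexp_eq_of_nonpos c w hv).symm) measurableSet_Iic

/-- `v ↦ e^{-c|v|} e^{iwv}` is integrable on `ℝ` (`c > 0`). [folklore] -/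
private theorem integrable_exp_neg_mul_abs_mul_cexp {c : ℝ} (hc : 0 < c) (w : ℝ) :
    Integrable fun v : ℝ ↦ (Real.exp (-(c * |v|)) : ℂ) * cexp (I * w * v) := by
  rw [← integrableOn_univ, ← Iic_union_Ioi (a := (0 : ℝ))]
  exact (integrableOn_exp_neg_mul_abs_mul_cexp_Iic hc w).union
    (integrableOn_exp_neg_mul_abs_mul_cexp_Ioi hc w)

/-- `v ↦ e^{-c|v|}` (complex-valued) is integrable on `ℝ` (`c > 0`; the `L¹` side of the
Poisson-kernel pair). [cite: Grafakos2014, Exercise 2.2.11 (b) (n = 1; the Poisson-kernel pair, dilated), PDF p. 133] -/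
theorem integrable_exp_neg_mul_abs {c : ℝ} (hc : 0 < c) :
    Integrable fun v : ℝ ↦ (Real.exp (-(c * |v|)) : ℂ) := by
  simpa using integrable_exp_neg_mul_abs_mul_cexp hc 0

/-- `v ↦ e^{-c|v|}` (complex-valued) is continuous. [folklore] -/
private theorem continuous_exp_neg_mul_abs (c : ℝ) :
    Continuous fun v : ℝ ↦ (Real.exp (-(c * |v|)) : ℂ) :=
  Complex.continuous_ofReal.comp
    (Real.continuous_exp.comp (continuous_const.mul continuous_abs).neg)

/-- **The Fourier transform of the two-sided exponential**:
`∫_ℝ e^{-c|v|} e^{iwv} dv = 2c/(c² + w²)` for `c > 0` and real `w`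
(`= 1/(c - iw) + 1/(c + iw)`, the two half-lines). [cite: Grafakos2014, Exercise 2.2.11 (b) (n = 1; the Poisson-kernel pair, dilated), PDF p. 133] -/
theorem integral_exp_neg_mul_abs_mul_cexp {c : ℝ} (hc : 0 < c) (w : ℝ) :
    ∫ v : ℝ, (Real.exp (-(c * |v|)) : ℂ) * cexp (I * w * v) =
      ((2 * c / (c ^ 2 + w ^ 2) : ℝ) : ℂ) := by
  rw [← intervalIntegral.integral_Iic_add_Ioi (integrableOn_exp_neg_mul_abs_mul_cexp_Iic hc w)
    (integrableOn_exp_neg_mul_abs_mul_cexp_Ioi hc w)]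
  have ha₁ : 0 < ((c : ℂ) + I * w).re := by simp [hc]
  have ha₂ : (-(c : ℂ) + I * w).re < 0 := by simp [hc]
  rw [setIntegral_congr_fun measurableSet_Iic
      (fun v hv ↦ exp_neg_mul_abs_mul_cexp_eq_of_nonpos c w hv),
    setIntegral_congr_fun measurableSet_Ioi
      (fun v hv ↦ exp_neg_mul_abs_mul_cexp_eq_of_pos c w hv),
    integral_exp_mul_complex_Iic ha₁, integral_exp_mul_complex_Ioi ha₂]
  have h₁ : (c : ℂ) + I * w ≠ 0 := fun h ↦ by simpa [hc.ne'] using congrArg Complex.re h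
  have h₂ : -(c : ℂ) + I * w ≠ 0 := fun h ↦ by simpa [hc.ne'] using congrArg Complex.re h
  have h₃ : ((c : ℂ) ^ 2 + (w : ℂ) ^ 2) ≠ 0 := by
    norm_cast
    positivity
  simp only [Complex.ofReal_zero, mul_zero, Complex.exp_zero]
  push_cast
  field_simp
  ring_nf
  simp only [Complex.I_sq]
  ring

/-- The same transform in Mathlib's normalisation: `𝓕[e^{-c|·|}](w) = 2c/(c² + (2πw)²)`
(at `c = 2π`: `(e^{-2π|x|})^(ξ) = 1/(π(1+ξ²))`, as printed). [cite: Grafakos2014, Exercise 2.2.11 (b) (n = 1; the Poisson-kernel pair, dilated), PDF p. 133] -/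
theorem fourier_exp_neg_mul_abs {c : ℝ} (hc : 0 < c) (w : ℝ) :
    𝓕 (fun v : ℝ ↦ (Real.exp (-(c * |v|)) : ℂ)) w =
      ((2 * c / (c ^ 2 + (2 * π * w) ^ 2) : ℝ) : ℂ) := by
  rw [Real.fourier_real_eq_integral_exp_smul]
  have h : ∀ v : ℝ, cexp (↑(-2 * π * v * w) * I) • (Real.exp (-(c * |v|)) : ℂ) =
      (Real.exp (-(c * |v|)) : ℂ) * cexp (I * ↑(-(2 * π * w)) * v) := by
    intro v
    rw [smul_eq_mul, mul_comm]
    congr 2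
    push_cast
    ring
  simp_rw [h]
  rw [integral_exp_neg_mul_abs_mul_cexp hc]
  congr 2
  ring

/-- `w ↦ 2c/(c² + (bw)²)` is integrable on `ℝ` for `c > 0`, `b ≠ 0` (a dilated Poisson kernel;
comparison with `(1 + w²)⁻¹`). [cite: Grafakos2014, Example 1.2.16 (the Poisson kernel P(x) = (π(x²+1))⁻¹ is in L¹), PDF p. 49] -/
theorem integrable_cauchyMultiplier {c b : ℝ} (hc : 0 < c) (hb : b ≠ 0) :
    Integrable fun w : ℝ ↦ 2 * c / (c ^ 2 + (b * w) ^ 2) := by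
  set m : ℝ := min (c ^ 2) (b ^ 2) with hm
  have hm0 : 0 < m := lt_min (by positivity) (by positivity)
  refine ((integrable_inv_one_add_sq.const_mul (2 * c / m))).mono' ?_ ?_
  · have hcont : Continuous fun w : ℝ ↦ 2 * c / (c ^ 2 + (b * w) ^ 2) := by
      refine Continuous.div continuous_const (by fun_prop) fun w ↦ ?_
      positivity
    exact hcont.aestronglyMeasurable
  · refine Eventually.of_forall fun w ↦ ?_
    have hden : 0 < c ^ 2 + (b * w) ^ 2 := by positivity
    rw [Real.norm_eq_abs, abs_of_nonneg (by positivity), ← div_eq_mul_inv, div_div]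
    refine div_le_div_of_nonneg_left (by positivity) (by positivity) ?_
    have h1 : m ≤ c ^ 2 := min_le_left _ _
    have h2 : m ≤ b ^ 2 := min_le_right _ _
    nlinarith [sq_nonneg w]

/-- The Mathlib Fourier transform of `e^{-c|·|}` is integrable (`c > 0`). [folklore] -/
private theorem integrable_fourier_exp_neg_mul_abs {c : ℝ} (hc : 0 < c) :
    Integrable (𝓕 (fun v : ℝ ↦ (Real.exp (-(c * |v|)) : ℂ))) := by
  have h : 𝓕 (fun v : ℝ ↦ (Real.exp (-(c * |v|)) : ℂ)) =
      fun w : ℝ ↦ ((2 * c / (c ^ 2 + (2 * π * w) ^ 2) : ℝ) : ℂ) :=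
    funext (fourier_exp_neg_mul_abs hc)
  rw [h]
  exact (integrable_cauchyMultiplier hc (by positivity : (2 * π : ℝ) ≠ 0)).ofReal

/-- **Fourier inversion for the two-sided exponential**:
`e^{-c|v|} = (1/2π) ∫_ℝ (2c/(c² + z²)) e^{izv} dz` (`c > 0`, `v ∈ ℝ`; both `e^{-c|·|}` and its
transform are integrable, so inversion holds pointwise). [cite: Grafakos2014, §2.2.4 with Exercise 2.2.6 (Fourier inversion on L¹ when f̂ ∈ L¹), PDF p. 129, and Exercise 2.2.11 (b), PDF p. 133] -/
theorem exp_neg_mul_abs_eq_integral {c : ℝ} (hc : 0 < c) (v : ℝ) :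
    (Real.exp (-(c * |v|)) : ℂ) =
      (1 / (2 * π) : ℝ) * ∫ z : ℝ, ((2 * c / (c ^ 2 + z ^ 2) : ℝ) : ℂ) * cexp (I * z * v) := by
  have hinv := congrFun ((continuous_exp_neg_mul_abs c).fourierInv_fourier_eq
    (integrable_exp_neg_mul_abs hc) (integrable_fourier_exp_neg_mul_abs hc)) v
  rw [← hinv, Real.fourierInv_eq_fourier_neg, Real.fourier_real_eq_integral_exp_smul]
  simp_rw [fourier_exp_neg_mul_abs hc, smul_eq_mul]
  have h : ∀ z : ℝ, cexp (↑(-2 * π * z * -v) * I) * (((2 * c / (c ^ 2 + (2 * π * z) ^ 2) : ℝ) : ℂ))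
      = (fun y : ℝ ↦ ((2 * c / (c ^ 2 + y ^ 2) : ℝ) : ℂ) * cexp (I * y * v)) ((2 * π) * z) := by
    intro z
    simp only [mul_comm (cexp _)]
    congr 2
    push_cast
    ring
  simp_rw [h]
  rw [MeasureTheory.Measure.integral_comp_mul_left
    (fun y : ℝ ↦ ((2 * c / (c ^ 2 + y ^ 2) : ℝ) : ℂ) * cexp (I * y * v)) (2 * π)]
  rw [Complex.real_smul, abs_of_pos (by positivity)]
  norm_num

/-! ### The quadratic form of the kernel `e^{-c|t-u|}` -/

/-- `conj ∘ f` is integrable when `f` is. [folklore] -/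
private theorem integrable_conj_comp {f : ℝ → ℂ} (hf : Integrable f) :
    Integrable fun x : ℝ ↦ conj (f x) :=
  hf.mono (Complex.continuous_conj.comp_aestronglyMeasurable hf.aestronglyMeasurable)
    (Eventually.of_forall fun x ↦ by simp)

/-- `(t, u) ↦ f(u) conj f(t)` is integrable on `ℝ × ℝ` when `f` is integrable. [folklore] -/
private theorem integrable_prod_mul_conj {f : ℝ → ℂ} (hf : Integrable f) :
    Integrable (fun p : ℝ × ℝ ↦ f p.2 * conj (f p.1)) (volume.prod volume) := by
  simpa [mul_comm] using (integrable_conj_comp hf).mul_prod hf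

/-- `conj (e^{izt}) = e^{-izt}` for real `z, t`. [folklore] -/
private theorem conj_cexp_I_mul_mul (z t : ℝ) : conj (cexp (I * z * t)) = cexp (-(I * z * t)) := by
  rw [← Complex.exp_conj, map_mul, map_mul, Complex.conj_I, Complex.conj_ofReal,
    Complex.conj_ofReal]
  ring_nf

/-- `∫ conj f(t) e^{-izt} dt = conj (∫ f(t) e^{izt} dt)`. [folklore] -/
private theorem integral_conj_mul_cexp_neg (f : ℝ → ℂ) (z : ℝ) :
    ∫ t : ℝ, conj (f t) * cexp (-(I * z * t)) = conj (∫ t : ℝ, f t * cexp (I * z * t)) := by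
  rw [← integral_conj]
  refine integral_congr_ae (Eventually.of_forall fun t ↦ ?_)
  simp only [map_mul, conj_cexp_I_mul_mul]

/-- `∫_{ℝ×ℝ} e^{iz(u-t)} f(u) conj f(t) = |∫ f(x)e^{izx}dx|²`. [folklore] -/
private theorem integral_prod_cexp_mul_mul_conj (f : ℝ → ℂ) (z : ℝ) :
    ∫ p : ℝ × ℝ, cexp (I * z * ((p.2 - p.1 : ℝ) : ℂ)) * (f p.2 * conj (f p.1)) ∂(volume.prod volume)
      = ((‖∫ x : ℝ, f x * cexp (I * z * x)‖ ^ 2 : ℝ) : ℂ) := by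
  have h : ∀ p : ℝ × ℝ, cexp (I * z * ((p.2 - p.1 : ℝ) : ℂ)) * (f p.2 * conj (f p.1)) =
      (conj (f p.1) * cexp (-(I * z * p.1))) * (f p.2 * cexp (I * z * p.2)) := by
    intro p
    rw [show cexp (I * z * ((p.2 - p.1 : ℝ) : ℂ)) = cexp (-(I * z * p.1)) * cexp (I * z * p.2) by
      rw [← Complex.exp_add]; congr 1; push_cast; ring]
    ring
  simp_rw [h]
  rw [integral_prod_mul (fun t : ℝ ↦ conj (f t) * cexp (-(I * z * t)))
    (fun u : ℝ ↦ f u * cexp (I * z * u)), integral_conj_mul_cexp_neg, Complex.conj_mul']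
  norm_cast

/-- Integrability of the triple integrand behind the Fubini step. [folklore] -/
private theorem integrable_cauchyMultiplier_mul_cexp_mul {c : ℝ} (hc : 0 < c) {f : ℝ → ℂ}
    (hf : Integrable f) :
    Integrable (fun q : (ℝ × ℝ) × ℝ ↦
      ((2 * c / (c ^ 2 + q.2 ^ 2) : ℝ) : ℂ) * cexp (I * q.2 * ((q.1.2 - q.1.1 : ℝ) : ℂ)) *
        (f q.1.2 * conj (f q.1.1))) ((volume.prod volume).prod volume) := by
  have hm : Integrable (fun z : ℝ ↦ ((2 * c / (c ^ 2 + z ^ 2) : ℝ) : ℂ)) := by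
    have := integrable_cauchyMultiplier hc one_ne_zero
    simp only [one_mul] at this
    exact this.ofReal
  have hprod := (integrable_prod_mul_conj hf).mul_prod hm
  have hphase : AEStronglyMeasurable
      (fun q : (ℝ × ℝ) × ℝ ↦ cexp (I * q.2 * ((q.1.2 - q.1.1 : ℝ) : ℂ)))
      ((volume.prod volume).prod volume) := by
    refine (Continuous.aestronglyMeasurable ?_)
    fun_prop
  refine (hprod.bdd_mul hphase (c := 1) (Eventually.of_forall fun q ↦ ?_)).congr
    (Eventually.of_forall fun q ↦ ?_)
  · rw [Complex.norm_exp]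
    simp only [Complex.mul_re, Complex.I_re, Complex.ofReal_re, zero_mul, Complex.I_im,
      Complex.ofReal_im, mul_zero, sub_zero, Complex.mul_im, one_mul, Real.exp_le_one_iff]
    nlinarith [mul_self_nonneg (q.2 * (q.1.2 - q.1.1))]
  · simp only
    ring

/-- **Plancherel form of the exponential kernel (product version).** For `c > 0` and an integrable
`f : ℝ → ℂ`,
`∫_{ℝ×ℝ} e^{-c|t-u|} f(u) conj f(t) d(t,u) = (1/2π) ∫_ℝ (2c/(c²+z²)) |∫ f(x)e^{izx}dx|² dz`
(substitute the inversion formula for the kernel and apply Fubini). [cite: Suzuki2023, §4.3, proof of Thm 4.2, eqs. (4.9)–(4.10), p. 9 (the kernel/multiplier identity (1/2π)∫|Φ₁(φ;z)|²dz = ∫∫φ(u)φ̄(t)K(t,u)dudt, here for the pair e^{-c|v|} ↔ 2c/(c²+z²))] -/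
theorem integral_prod_exp_neg_mul_abs_sub {c : ℝ} (hc : 0 < c) {f : ℝ → ℂ} (hf : Integrable f) :
    ∫ p : ℝ × ℝ, (Real.exp (-(c * |p.1 - p.2|)) : ℂ) * f p.2 * conj (f p.1) ∂(volume.prod volume) =
      (1 / (2 * π) : ℝ) * ∫ z : ℝ,
        (((2 * c / (c ^ 2 + z ^ 2)) * ‖∫ x : ℝ, f x * cexp (I * z * x)‖ ^ 2 : ℝ) : ℂ) := by
  -- substitute the kernel by its spectral integral
  have hker : ∀ p : ℝ × ℝ, (Real.exp (-(c * |p.1 - p.2|)) : ℂ) * f p.2 * conj (f p.1) =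
      ∫ z : ℝ, ((1 / (2 * π) : ℝ) : ℂ) * (((2 * c / (c ^ 2 + z ^ 2) : ℝ) : ℂ) *
        cexp (I * z * ((p.2 - p.1 : ℝ) : ℂ)) * (f p.2 * conj (f p.1))) := by
    intro p
    have hassoc : ∀ A B C D : ℂ, A * B * C * D = A * (B * (C * D)) := fun _ _ _ _ ↦ by ring
    rw [abs_sub_comm, exp_neg_mul_abs_eq_integral hc (p.2 - p.1), hassoc, ← integral_mul_const,
      ← integral_const_mul]
  simp_rw [hker]
  -- Fubini
  have hH := integrable_cauchyMultiplier_mul_cexp_mul hc hf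
  rw [integral_integral_swap ((hH.const_mul (((1 / (2 * π) : ℝ) : ℂ))).congr
    (Eventually.of_forall fun q ↦ rfl))]
  -- the inner integral
  have hinner : ∀ z : ℝ, ∫ p : ℝ × ℝ, ((1 / (2 * π) : ℝ) : ℂ) *
      (((2 * c / (c ^ 2 + z ^ 2) : ℝ) : ℂ) * cexp (I * z * ((p.2 - p.1 : ℝ) : ℂ)) *
        (f p.2 * conj (f p.1))) ∂(volume.prod volume) =
      ((1 / (2 * π) : ℝ) : ℂ) *
        ((((2 * c / (c ^ 2 + z ^ 2)) * ‖∫ x : ℝ, f x * cexp (I * z * x)‖ ^ 2 : ℝ) : ℂ)) := by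
    intro z
    have hfun : (fun p : ℝ × ℝ ↦ ((1 / (2 * π) : ℝ) : ℂ) *
        (((2 * c / (c ^ 2 + z ^ 2) : ℝ) : ℂ) * cexp (I * z * ((p.2 - p.1 : ℝ) : ℂ)) *
          (f p.2 * conj (f p.1)))) =
        fun p : ℝ × ℝ ↦ (((1 / (2 * π) : ℝ) : ℂ) * (((2 * c / (c ^ 2 + z ^ 2) : ℝ) : ℂ))) *
          (cexp (I * z * ((p.2 - p.1 : ℝ) : ℂ)) * (f p.2 * conj (f p.1))) := by
      ext p
      ring
    rw [hfun, integral_const_mul, integral_prod_cexp_mul_mul_conj]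
    push_cast
    ring
  simp_rw [hinner]
  rw [integral_const_mul]

/-- **Plancherel form of the exponential kernel (iterated version).** For `c > 0` and an
integrable `f : ℝ → ℂ`,
`∫_ℝ ∫_ℝ e^{-c|t-u|} f(u) conj f(t) du dt = (1/2π) ∫_ℝ (2c/(c²+z²)) |∫ f(x)e^{izx}dx|² dz`.
[cite: Suzuki2023, §4.3, proof of Thm 4.2, eqs. (4.9)–(4.10), p. 9 (the kernel/multiplier identity (1/2π)∫|Φ₁(φ;z)|²dz = ∫∫φ(u)φ̄(t)K(t,u)dudt, here for the pair e^{-c|v|} ↔ 2c/(c²+z²))] -/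
theorem integral_integral_exp_neg_mul_abs_sub {c : ℝ} (hc : 0 < c) {f : ℝ → ℂ}
    (hf : Integrable f) :
    ∫ t : ℝ, ∫ u : ℝ, (Real.exp (-(c * |t - u|)) : ℂ) * f u * conj (f t) =
      (1 / (2 * π) : ℝ) * ∫ z : ℝ,
        (((2 * c / (c ^ 2 + z ^ 2)) * ‖∫ x : ℝ, f x * cexp (I * z * x)‖ ^ 2 : ℝ) : ℂ) := by
  rw [← integral_prod_exp_neg_mul_abs_sub hc hf, integral_prod]
  -- integrability of the kernel form on `ℝ × ℝ`
  have hphase : AEStronglyMeasurable (fun p : ℝ × ℝ ↦ (Real.exp (-(c * |p.1 - p.2|)) : ℂ))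
      (volume.prod volume) := by
    refine Continuous.aestronglyMeasurable ?_
    fun_prop
  refine ((integrable_prod_mul_conj hf).bdd_mul hphase (c := 1)
    (Eventually.of_forall fun p ↦ ?_)).congr (Eventually.of_forall fun p ↦ ?_)
  · rw [Complex.norm_real, Real.norm_eq_abs, abs_of_pos (Real.exp_pos _), Real.exp_le_one_iff,
      neg_nonpos]
    positivity
  · simp only
    ring

/-- The spectral integral is a non-negative real number: the quadratic form of `e^{-c|t-u|}`
is `≥ 0` (positive-definiteness of the two-sided exponential). [cite: Suzuki2023, §4.3, proof of Thm 4.2, eqs. (4.9)–(4.10), p. 9 (the kernel/multiplier identity (1/2π)∫|Φ₁(φ;z)|²dz = ∫∫φ(u)φ̄(t)K(t,u)dudt, here for the pair e^{-c|v|} ↔ 2c/(c²+z²))] -/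
theorem integral_integral_exp_neg_mul_abs_sub_eq_ofReal {c : ℝ} (hc : 0 < c) {f : ℝ → ℂ}
    (hf : Integrable f) :
    ∫ t : ℝ, ∫ u : ℝ, (Real.exp (-(c * |t - u|)) : ℂ) * f u * conj (f t) =
      ((1 / (2 * π) * ∫ z : ℝ,
        (2 * c / (c ^ 2 + z ^ 2)) * ‖∫ x : ℝ, f x * cexp (I * z * x)‖ ^ 2 : ℝ) : ℂ) := by
  rw [integral_integral_exp_neg_mul_abs_sub hc hf]
  push_cast
  congr 1
  rw [← integral_complex_ofReal]
  push_cast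
  rfl

/-- Non-negativity of the spectral integral `(1/2π)∫ (2c/(c²+z²)) |f̂(z)|² dz`. [cite: Suzuki2023, §4.3, proof of Thm 4.2, eqs. (4.9)–(4.10), p. 9 (the kernel/multiplier identity (1/2π)∫|Φ₁(φ;z)|²dz = ∫∫φ(u)φ̄(t)K(t,u)dudt, here for the pair e^{-c|v|} ↔ 2c/(c²+z²))] -/
theorem spectral_integral_exp_neg_mul_abs_nonneg {c : ℝ} (hc : 0 < c) (f : ℝ → ℂ) :
    0 ≤ 1 / (2 * π) * ∫ z : ℝ,
        (2 * c / (c ^ 2 + z ^ 2)) * ‖∫ x : ℝ, f x * cexp (I * z * x)‖ ^ 2 := by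
  have : 0 ≤ ∫ z : ℝ, (2 * c / (c ^ 2 + z ^ 2)) * ‖∫ x : ℝ, f x * cexp (I * z * x)‖ ^ 2 :=
    integral_nonneg fun z ↦ by positivity
  positivity

end Literature.Analysis.Fourier

end
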